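import Mathlib
import Summits.ValiantsHypothesis.ValiantsHypothesis.Theorems.LacunarySymmetroidMatrixDescartesCensusRealExponentsFamilyTransfer
import Summits.ValiantsHypothesis.ValiantsHypothesis.Theorems.LacunarySymmetroidMatrixDescartesCensusRealExponentsThreeByThreeKit
import Summits.ValiantsHypothesis.ValiantsHypothesis.Theorems.LacunarySymmetroidMatrixDescartesCensusRealExponentsCubicSigns

/-!
# `MatrixDescartes` census — `3 × 3` pencils: the real-exponent transfer for EVERY bound (non-sharp rows included)

HONEST FRAMING.  Object-search cell `pub-symmetroid`, item `DoorA34 = PosRootLawAt 3 4 18`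
(stmt-ValiantsHypothesis-19980; OPEN, typed, never asserted) and the cell's `(3,K,B)` rows at every
count level; this file proves an EQUIVALENCE about the `m = 3` rows and decides nothing.  Nothing here
bears on `MatrixDescartes` (stmt-ValiantsHypothesis-18050) or `VP ≠ VNP`.

`posRootLawAt_iff_rpow` (…Doors) needs a SHARP bound (all zeros of a counterexample simple);
`posRootLawAt_two_iff_rpow` (…TwoByTwo) removed the hypothesis for `2 × 2` letters.  Here:

* `exists_signVar_of_zeros_three` — the constructive core: if `t ↦ det ∑_l e^{δ_l t} S_l` (`S_l` real
  symmetric `3 × 3`) has at least `N ≥ 1` zeros, then after perturbing ONE letter, `S₀ ↦ S₀ + εW`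
  (`W` symmetric), the pencil has at least `N` consecutive sign variations along a strictly increasing
  point sequence (same exponents);
* `posRootLawAt_three_iff_rpow` — **for every `K` and every `B`:
  `PosRootLawAt 3 K B ↔ ∀ δ : Fin K → ℝ, ∀ S symmetric, #{x > 0 : det ∑_l x^{δ_l} S_l = 0} ≤ B`.**
  So every census register `ζ_sym(3,K)` (all levels, not only the Descartes-sharp one) is a statement
  about real exponent vectors; `not_posRootLawAt_three_iff` is the negation currency.

PROOF (→; ← is `posRootLawAt_of_rpow`): report DOOR-A-P1-REPORT §29, SPEC A.  A real-exponent
counterexample `G = det F`, `F(t) = ∑ e^{δ_l t} S_l`, with `≥ B + 1` zeros (as `Set.ncard`) has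
finitely many.  Perturb ONE letter, `S₀ ↦ S₀ + εM_w`, over the four-member family `M_w ∈ {±1, ±W}`, `W = 1 − κ·nnᵀ`:
`det(F + εE·M) = (εE)·tr(adj F·M) + (εE)²·tr(adj M·F) + (εE)³·det M` at a zero
(`det_add_smul_fin_three`).  At a CORANK-ONE zero (`adj F(z) ≠ 0`) the first order is
`±tr adj F(z) ≠ 0` (`trace_adjugate_ne_zero_of_isSymm`) resp. `±(tr adj F(z) − κ·nᵀadj F(z)n) ≠ 0`
(choice of `κ`); at a CORANK-TWO zero (`adj F(z) = 0 ≠ F(z)`) the first order vanishes and the second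
order is `tr F(z) ≠ 0` (`eq_zero_of_adjugate_eq_zero_of_trace_eq_zero`) for `±1` and
`tr F(z) − κ·(|n|² tr F(z) − nᵀF(z)n)` of the OPPOSITE sign for `±W` (the defect
`tr F·(|n|² tr F − nᵀFn)` is a sum of squares on the rank-one locus, positive once `n = (1,t,t²)`
is taken off the finitely many bad parameters `t`, and `κ` is large); at a zero with `F(z) = 0` the
third order `±det M` decides.  In all cases exactly half of the family is eventually negative and
half eventually positive (`balance_four`), so `exists_signVar_of_zeros_family` yields a member and an
`ε` with `≥ B + 1` sign variations of a symmetric real-exponent pencil on the SAME exponents,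
contradicting `card_signVar_le`.

[folklore] Elementary perturbation theory of symmetric `3 × 3` pencils; Laguerre via the kit.
-/

-- `Summit.ValiantsHypothesis.ValiantsHypothesis.…` repeats a component by the D-0017 layout
-- (single-conjunct summit), which the `dupNamespace` linter flags; the name is mandated.
set_option linter.dupNamespace false

namespace Summit.ValiantsHypothesis.ValiantsHypothesis.Theorems.LacunarySymmetroidMatrixDescartes.Census.RealExp

open Finset Filter Topology Matrix
open scoped BigOperators Matrix
open Summit.ValiantsHypothesis.ValiantsHypothesis.Theorems.MatrixDescartes.Negative (PosRootLawAt)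

section ThreeByThree

/-- A sum of scalar multiples of symmetric matrices is symmetric. [folklore] -/
theorem isSymm_sum_smul {m K : ℕ} (c : Fin K → ℝ) (S : Fin K → Matrix (Fin m) (Fin m) ℝ)
    (hS : ∀ l, (S l).IsSymm) : (∑ l, c l • S l).IsSymm := by
  unfold Matrix.IsSymm
  rw [Matrix.transpose_sum]
  exact Finset.sum_congr rfl fun l _ => by rw [Matrix.transpose_smul, (hS l).eq]

-- One long elementary proof (choice of the direction `n`, of `κ`, and the corank bookkeeping at
-- every zero); measured above the default budget.
set_option maxHeartbeats 800000 in
open Classical in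
/-- **Zeros become sign variations after a one-letter perturbation (`3 × 3`, real exponents).**  If
`t ↦ det ∑_l e^{δ_l t} S_l` (any number `k+1` of real symmetric `3 × 3` letters) has at least `N ≥ 1`
zeros, then for some symmetric `W` and some `ε` the pencil with `S₀` replaced by `S₀ + εW` has at least
`N` consecutive sign variations along some strictly increasing point sequence `p₀ < ⋯ < p_M`
(module docstring; report §29 SPEC A). [folklore] -/
theorem exists_signVar_of_zeros_three {k N : ℕ} (δ : Fin (k + 1) → ℝ)
    (S : Fin (k + 1) → Matrix (Fin 3) (Fin 3) ℝ) (hS : ∀ l, (S l).IsSymm) (hN0 : 0 < N)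
    (hN : N ≤ {t : ℝ | (∑ l, Real.exp (δ l * t) • S l).det = 0}.ncard) :
    ∃ (W : Matrix (Fin 3) (Fin 3) ℝ) (ε : ℝ), W.IsSymm ∧ ∃ (M : ℕ) (p : Fin (M + 1) → ℝ),
      StrictMono p ∧ N ≤ (univ.filter (fun i : Fin M =>
        (∑ l, Real.exp (δ l * p i.castSucc) • Function.update S 0 (S 0 + ε • W) l).det *
        (∑ l, Real.exp (δ l * p i.succ) • Function.update S 0 (S 0 + ε • W) l).det < 0)).card := by
  classical
  -- the real-exponent pencil, its determinant and its (finite) zero set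
  set F : ℝ → Matrix (Fin 3) (Fin 3) ℝ := fun t => ∑ l, Real.exp (δ l * t) • S l with hF
  set G : ℝ → ℝ := fun t => (F t).det with hG
  have hFsymm : ∀ t, (F t).IsSymm := fun t => isSymm_sum_smul _ S hS
  set Zt : Set ℝ := {t | G t = 0} with hZt
  change N ≤ Zt.ncard at hN
  have hfin : Zt.Finite := Set.finite_of_ncard_ne_zero (by omega)
  obtain ⟨Zf, hZfmem⟩ : ∃ Zf : Finset ℝ, ∀ x, x ∈ Zf ↔ x ∈ Zt :=
    ⟨hfin.toFinset, fun x => hfin.mem_toFinset⟩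
  have hZf : ∀ z, G z = 0 → z ∈ Zf := fun z hz => (hZfmem z).mpr hz
  -- STEP 1: the direction `n = (1, t, t²)` off every corank-two zero
  set nv : ℝ → (Fin 3 → ℝ) := fun t => ![1, t, t ^ 2] with hnv
  set Bad : ℝ → Set ℝ := fun z =>
    {t | (F z).adjugate = 0 ∧ F z ≠ 0 ∧ (F z) *ᵥ nv t = (F z).trace • nv t} with hBad
  have hBad_sub : ∀ z, (Bad z).Subsingleton := by
    intro z t ht t' ht'
    simp only [hBad, Set.mem_setOf_eq] at ht ht'
    obtain ⟨hadj, hne, hn⟩ := ht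
    obtain ⟨-, -, hn'⟩ := ht'
    have hdef : ∀ s, (F z) *ᵥ nv s = (F z).trace • nv s →
        F z = (F z) 0 0 • vecMulVec ![1, s, s ^ 2] ![1, s, s ^ 2] := by
      intro s hs
      refine eq_smul_vecMulVec_of_defect_eq_zero (hFsymm z) hadj s ?_
      have : ![1, s, s ^ 2] ⬝ᵥ (F z) *ᵥ ![1, s, s ^ 2] = (F z).trace * (![1, s, s ^ 2] ⬝ᵥ ![1, s, s ^ 2]) := by
        change nv s ⬝ᵥ (F z) *ᵥ nv s = _
        rw [hs, dotProduct_smul, smul_eq_mul]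
      rw [this]; ring
    have h00 : (F z) 0 0 ≠ 0 := by
      intro h0
      apply hne
      rw [hdef t hn, h0, zero_smul]
    exact eq_of_smul_vecMulVec_eq h00 ((hdef t hn).symm.trans (hdef t' hn'))
  have hBadfin : (⋃ z ∈ (↑Zf : Set ℝ), Bad z).Finite :=
    Set.Finite.biUnion Zf.finite_toSet fun z _ => (hBad_sub z).finite
  obtain ⟨t, ht⟩ := hBadfin.exists_notMem
  set n : Fin 3 → ℝ := nv t with hn
  have hn_good : ∀ z, G z = 0 → (F z).adjugate = 0 → F z ≠ 0 → (F z) *ᵥ n ≠ (F z).trace • n := by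
    intro z hz hadj hne heq
    apply ht
    rw [Set.mem_iUnion₂]
    exact ⟨z, hZf z hz, hadj, hne, heq⟩
  have hnn : 1 ≤ n ⬝ᵥ n := by
    simp only [hn, hnv, dotProduct, Fin.sum_univ_three, Matrix.cons_val_zero, Matrix.cons_val_one,
      Matrix.head_cons, Matrix.cons_val_two, Matrix.tail_cons]
    nlinarith [sq_nonneg t, sq_nonneg (t ^ 2)]
  -- the defect at the corank-two zeros is positive
  set D : ℝ → ℝ := fun z => (F z).trace * ((n ⬝ᵥ n) * (F z).trace - n ⬝ᵥ (F z) *ᵥ n) with hD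
  have hDpos : ∀ z, G z = 0 → (F z).adjugate = 0 → F z ≠ 0 → 0 < D z := by
    intro z hz hadj hne
    rcases (trace_mul_defect_nonneg (hFsymm z) hadj n).eq_or_lt with h0 | hpos
    · exfalso
      apply hn_good z hz hadj hne
      have hFz := eq_smul_vecMulVec_of_defect_eq_zero (hFsymm z) hadj t
        (by simp only [hn, hnv] at h0; exact h0.symm)
      have htr : (F z).trace = (F z) 0 0 * (n ⬝ᵥ n) := by
        rw [congrArg Matrix.trace hFz, Matrix.trace_smul, smul_eq_mul, Matrix.trace_vecMulVec]
      have key : ((F z) 0 0 • vecMulVec ![1, t, t ^ 2] ![1, t, t ^ 2]) *ᵥ n = ((F z) 0 0 * (n ⬝ᵥ n)) • n := by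
        ext i
        fin_cases i <;> simp [vecMulVec, Matrix.mulVec, dotProduct, Fin.sum_univ_three, hn, hnv] <;> ring
      calc (F z) *ᵥ n = ((F z) 0 0 • vecMulVec ![1, t, t ^ 2] ![1, t, t ^ 2]) *ᵥ n :=
            congrArg (· *ᵥ n) hFz
        _ = ((F z) 0 0 * (n ⬝ᵥ n)) • n := key
        _ = (F z).trace • n := by rw [htr]
    · exact hpos
  -- STEP 2: the size `κ` of the dent: beyond every first-order cancellation and every second-order threshold
  set κ : ℝ := 2 + ∑ z ∈ Zf, (|(F z).adjugate.trace / (n ⬝ᵥ (F z).adjugate *ᵥ n)| + |(F z).trace ^ 2 / D z|)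
    with hκ
  have hκ_ge : ∀ z ∈ Zf, |(F z).adjugate.trace / (n ⬝ᵥ (F z).adjugate *ᵥ n)| + |(F z).trace ^ 2 / D z| + 2 ≤ κ := by
    intro z hz
    rw [hκ]
    have := Finset.single_le_sum (f := fun z => |(F z).adjugate.trace / (n ⬝ᵥ (F z).adjugate *ᵥ n)| +
      |(F z).trace ^ 2 / D z|) (fun z _ => by positivity) hz
    linarith
  have hκ1 : 1 < κ := by
    have := Finset.sum_nonneg (s := Zf) (f := fun z => |(F z).adjugate.trace / (n ⬝ᵥ (F z).adjugate *ᵥ n)| +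
      |(F z).trace ^ 2 / D z|) (fun z _ => by positivity)
    rw [hκ]; linarith
  set W : Matrix (Fin 3) (Fin 3) ℝ := (1 : Matrix (Fin 3) (Fin 3) ℝ) - κ • vecMulVec n n with hW
  have hWsymm : W.IsSymm := isSymm_one_sub_smul_vecMulVec κ n
  have hWdet : W.det < 0 := by
    rw [hW, det_one_sub_smul_vecMulVec]; nlinarith
  -- first order at corank-one zeros: `tr(adj F·W) ≠ 0`
  have hfirst : ∀ z, G z = 0 → (F z).adjugate ≠ 0 → ((F z).adjugate * W).trace ≠ 0 := by
    intro z hz hadj h0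
    have htr := trace_adjugate_ne_zero_of_isSymm (hFsymm z) hz hadj
    rw [hW, trace_mul_one_sub_smul_vecMulVec] at h0
    set q := n ⬝ᵥ (F z).adjugate *ᵥ n with hq
    have hq0 : q ≠ 0 := by
      intro hq0; rw [hq0, mul_zero, sub_zero] at h0; exact htr h0
    have hκeq : κ = (F z).adjugate.trace / q := by
      field_simp; linarith
    have hle := hκ_ge z (hZf z hz)
    have : (F z).adjugate.trace / q ≤ |(F z).adjugate.trace / q| := le_abs_self _
    have : 0 ≤ |(F z).trace ^ 2 / D z| := abs_nonneg _
    linarith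
  -- second order at corank-two zeros: `tr F · tr(adj W·F) < 0`
  have hsecond : ∀ z, G z = 0 → (F z).adjugate = 0 → F z ≠ 0 →
      (F z).trace * (W.adjugate * F z).trace < 0 := by
    intro z hz hadj hne
    have hDz := hDpos z hz hadj hne
    rw [hW, trace_adjugate_one_sub_smul_vecMulVec_mul]
    have hexp : (F z).trace * ((1 - κ * (n ⬝ᵥ n)) * (F z).trace + κ * (n ⬝ᵥ (F z) *ᵥ n)) =
        (F z).trace ^ 2 - κ * D z := by rw [hD]; ring
    rw [hexp]
    have hle := hκ_ge z (hZf z hz)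
    have h1 : (F z).trace ^ 2 / D z ≤ |(F z).trace ^ 2 / D z| := le_abs_self _
    have h2 : 0 ≤ |(F z).adjugate.trace / (n ⬝ᵥ (F z).adjugate *ᵥ n)| := abs_nonneg _
    have hlt : (F z).trace ^ 2 / D z < κ := by linarith
    have := (div_lt_iff₀ hDz).mp hlt
    linarith
  -- STEP 3: the four-member family and the perturbed determinants
  set V : Bool → Matrix (Fin 3) (Fin 3) ℝ := fun b => if b then 1 else W with hV
  set sg : Bool → ℝ := fun b => if b then 1 else -1 with hsg
  set M : Bool × Bool → Matrix (Fin 3) (Fin 3) ℝ := fun w => sg w.2 • V w.1 with hM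
  have hVsymm : ∀ b, (V b).IsSymm := fun b => by
    cases b
    · exact hWsymm
    · exact Matrix.isSymm_one
  have hMsymm : ∀ w, (M w).IsSymm := fun w => (hVsymm w.1).smul _
  have hVdet : ∀ b, (V b).det ≠ 0 := fun b => by
    cases b
    · exact hWdet.ne
    · simp [hV]
  set P : Bool × Bool → ℝ → ℝ → ℝ := fun w ε t => (F t + (ε * Real.exp (δ 0 * t)) • M w).det with hP
  have hP_det : ∀ w ε t, (∑ l, Real.exp (δ l * t) • Function.update S 0 (S 0 + ε • M w) l).det = P w ε t := by
    intro w ε t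
    rw [expPencil_update_zero]
  have hP0 : ∀ w t, P w 0 t = G t := fun w t => by simp [hP, hG]
  have hPcont : ∀ w t, Continuous fun ε => P w ε t := by
    intro w t
    simp only [hP]
    exact (continuous_const.add ((continuous_id.mul continuous_const).smul continuous_const)).matrix_det
  -- the expansion at a zero, for the two signs
  set a : ℝ → Bool → ℝ := fun z b => ((F z).adjugate * V b).trace with ha
  set b2 : ℝ → Bool → ℝ := fun z b => ((V b).adjugate * F z).trace with hb2
  set c3 : Bool → ℝ := fun b => (V b).det with hc3
  have hexpT : ∀ z, G z = 0 → ∀ b ε, P (b, true) ε z =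
      (ε * Real.exp (δ 0 * z)) * a z b + (ε * Real.exp (δ 0 * z)) ^ 2 * b2 z b +
        (ε * Real.exp (δ 0 * z)) ^ 3 * c3 b := by
    intro z hz b ε
    simp only [hP, hM, hsg, if_true, one_smul]
    rw [det_add_smul_fin_three]
    change G z + _ + _ + _ = _
    rw [hz, zero_add]
  have hexpF : ∀ z, G z = 0 → ∀ b ε, P (b, false) ε z =
      (ε * Real.exp (δ 0 * z)) * (-a z b) + (ε * Real.exp (δ 0 * z)) ^ 2 * b2 z b +
        (ε * Real.exp (δ 0 * z)) ^ 3 * (-c3 b) := by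
    intro z hz b ε
    simp only [hP, hM, hsg]
    simp only [Bool.false_eq_true, if_false]
    rw [show F z + (ε * Real.exp (δ 0 * z)) • ((-1 : ℝ) • V b) =
      F z + (-(ε * Real.exp (δ 0 * z))) • V b by rw [smul_smul]; ring_nf]
    rw [det_add_smul_fin_three]
    change G z + _ + _ + _ = _
    rw [hz, zero_add]
    simp only [ha, hb2, hc3]
    ring
  -- (a) non-vanishing and (b) balance at every zero
  have hPne : ∀ w z, G z = 0 → ∀ᶠ ε in 𝓝[>] (0 : ℝ), P w ε z ≠ 0 := by
    intro w z hz
    have hE : 0 < Real.exp (δ 0 * z) := Real.exp_pos _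
    obtain ⟨b, s⟩ := w
    cases s
    · refine (cubic_eventually_ne_zero (a := -a z b) (b := b2 z b) hE
        (neg_ne_zero.mpr (hVdet b))).mono fun ε h => ?_
      rw [hexpF z hz]; exact h
    · refine (cubic_eventually_ne_zero (a := a z b) (b := b2 z b) hE (hVdet b)).mono fun ε h => ?_
      rw [hexpT z hz]; exact h
  have hbal : ∀ z, G z = 0 →
      Fintype.card (Bool × Bool) ≤ 2 * (univ.filter (fun w => ∀ᶠ ε in 𝓝[>] (0 : ℝ), P w ε z < 0)).card ∧
      Fintype.card (Bool × Bool) ≤ 2 * (univ.filter (fun w => ∀ᶠ ε in 𝓝[>] (0 : ℝ), 0 < P w ε z)).card := by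
    intro z hz
    have hE : 0 < Real.exp (δ 0 * z) := Real.exp_pos _
    refine balance_four (a z) (b2 z) c3 hE (fun w ε => P w ε z) (fun b ε => hexpT z hz b ε)
      (fun b ε => hexpF z hz b ε) ?_
    by_cases hadj : (F z).adjugate = 0
    · by_cases hFz : F z = 0
      · -- corank three: only the third order survives
        right; right
        refine ⟨?_, ?_, ?_, ?_, hVdet true, hVdet false⟩
        · simp [ha, hadj]
        · simp [ha, hadj]
        · simp [hb2, hFz]
        · simp [hb2, hFz]
      · -- corank two: second order, opposite signs for `1` and `W`
        right; left
        have htr : (F z).trace ≠ 0 := fun h0 =>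
          hFz (eq_zero_of_adjugate_eq_zero_of_trace_eq_zero (hFsymm z) hadj h0)
        have h2 := hsecond z hz hadj hFz
        refine ⟨by simp [ha, hadj], by simp [ha, hadj], ?_⟩
        simp only [hb2, hV, if_true, Bool.false_eq_true, if_false, Matrix.adjugate_one, Matrix.one_mul]
        exact h2
    · -- corank one: first order for both letters
      left
      refine ⟨?_, ?_⟩
      · simp only [ha, hV, if_true, Matrix.mul_one]
        exact trace_adjugate_ne_zero_of_isSymm (hFsymm z) hz hadj
      · simp only [ha, hV, Bool.false_eq_true, if_false]
        exact hfirst z hz hadj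
  -- STEP 4: the family lemma
  obtain ⟨w, ε, Mn, p, hpmono, hcount⟩ := exists_signVar_of_zeros_family (ι := Bool × Bool) G hfin
    hN0 hN P hP0 hPcont (fun w z hz => hPne w z hz) hbal
  refine ⟨M w, ε, hMsymm w, Mn, p, hpmono, ?_⟩
  simp only [hP_det]
  exact hcount

/-- **The `3 × 3` real-exponent transfer for EVERY bound.**  For all `K`, `B`:
`PosRootLawAt 3 K B` (every real symmetric `3 × 3` pencil with `K` lacunary terms on an INTEGER support
has `≤ B` distinct positive det-roots) iff the same holds for every REAL exponent vector
`δ : Fin K → ℝ` (zeros of `x ↦ det ∑_l x^{δ_l} S_l` on `(0,∞)`, `Set.ncard`).  No sharpness hypothesis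
(module docstring; report §29 SPEC A). [folklore] -/
theorem posRootLawAt_three_iff_rpow (K B : ℕ) :
    PosRootLawAt 3 K B ↔
      ∀ (δ : Fin K → ℝ) (S : Fin K → Matrix (Fin 3) (Fin 3) ℝ), (∀ l, (S l).IsSymm) →
        {x : ℝ | 0 < x ∧ (∑ l, (x ^ (δ l)) • S l).det = 0}.ncard ≤ B := by
  classical
  refine ⟨fun hlaw δ S hS => ?_, posRootLawAt_of_rpow⟩
  rcases K.eq_zero_or_pos with hK | hK
  · subst hK
    have : {x : ℝ | 0 < x ∧ (∑ l : Fin 0, (x ^ (δ l)) • S l).det = 0} = Set.Ioi 0 := by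
      ext x
      simp
    rw [this, (Set.Ioi_infinite 0).ncard]
    exact Nat.zero_le B
  obtain ⟨k, rfl⟩ : ∃ k, K = k + 1 := ⟨K - 1, by omega⟩
  by_contra hcon
  push Not at hcon
  rw [ncard_rpow_eq_ncard_exp δ S] at hcon
  obtain ⟨W, ε, hW, M, p, hp, hvar⟩ := exists_signVar_of_zeros_three δ S hS (Nat.succ_pos B) hcon
  have hbound := card_signVar_le hlaw δ _ (isSymm_update_zero S hS W hW ε) p hp
  omega

/-- **The negation currency over real exponents (`3 × 3`, every bound).**  `¬ PosRootLawAt 3 K B`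
iff some REAL exponent vector carries a real symmetric `3 × 3` pencil with `≥ B + 1` zeros on `(0,∞)`.
[folklore] -/
theorem not_posRootLawAt_three_iff (K B : ℕ) :
    ¬ PosRootLawAt 3 K B ↔ ∃ (δ : Fin K → ℝ) (S : Fin K → Matrix (Fin 3) (Fin 3) ℝ),
      (∀ l, (S l).IsSymm) ∧ B + 1 ≤ {x : ℝ | 0 < x ∧ (∑ l, (x ^ (δ l)) • S l).det = 0}.ncard := by
  rw [posRootLawAt_three_iff_rpow]
  push Not
  constructor
  · rintro ⟨δ, S, hS, h⟩; exact ⟨δ, S, hS, by omega⟩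
  · rintro ⟨δ, S, hS, h⟩; exact ⟨δ, S, hS, by omega⟩

end ThreeByThree

end Summit.ValiantsHypothesis.ValiantsHypothesis.Theorems.LacunarySymmetroidMatrixDescartes.Census.RealExp
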